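import Summits.MatrixMultiplication.OmegaCensus.STPP222IcosetHSearch
import Mathlib.Tactic.IntervalCases

/-!
# ω-census, icoset class negatives: kernel evaluation chunks for `𝔽₂³ × ℤ₁₁`, `K = 6` (part D: `b₁ = 4`)

HONEST FRAMING (pub-omega census; verbatim): lottery ticket; floor = certified bounds/negative ranges.
Census STRUCTURE bookkeeping (Q7), nothing about `ω`.  Pure kernel evaluations of `IcosetH.checkFrom (cyc 11) 6 x y` (the subtree of the
H-stage search below the level-1 choice `(b₁, c₁) = (x, y)`; engine `STPP222IcosetHSearch.lean`, soundness `STPP222IcosetHSearchSound.lean`),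
one `decide +kernel` per `(x, y)` with ≥ 300 search nodes, light ones grouped; the parts are assembled into `IcosetH.check (cyc 11) 6 = true`
and the class negative in `STPP222IcosetClassNoneK6Z11.lean`.  Node counts (seat prototype = ENG2 icoset3; 151 112 in all; ≈ 8 ms/node on the
farm): (4,1): 2030, (4,2): 1933, (4,3): 2030, (4,5): 1776, (4,6): 1557, (4,7): 1435, (4,8): 1435, (4,9): 1557, (4,10): 1776 — this file 15529 nodes.  Seat pub-omega-kernel-l4 (gen 19), 2026-08-27.
-/

namespace Summit.MatrixMultiplication.OmegaCensus

namespace IcosetH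

/-- Kernel evaluation of the `(b₁, c₁) = (4, 1)` subtree (2030 nodes). -/
theorem checkFrom_cyc11_4_1 : checkFrom (cyc 11) 6 4 1 = true := by decide +kernel

/-- Kernel evaluation of the `(b₁, c₁) = (4, 2)` subtree (1933 nodes). -/
theorem checkFrom_cyc11_4_2 : checkFrom (cyc 11) 6 4 2 = true := by decide +kernel

/-- Kernel evaluation of the `(b₁, c₁) = (4, 3)` subtree (2030 nodes). -/
theorem checkFrom_cyc11_4_3 : checkFrom (cyc 11) 6 4 3 = true := by decide +kernel

/-- Kernel evaluation of the `(b₁, c₁) = (4, 5)` subtree (1776 nodes). -/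
theorem checkFrom_cyc11_4_5 : checkFrom (cyc 11) 6 4 5 = true := by decide +kernel

/-- Kernel evaluation of the `(b₁, c₁) = (4, 6)` subtree (1557 nodes). -/
theorem checkFrom_cyc11_4_6 : checkFrom (cyc 11) 6 4 6 = true := by decide +kernel

/-- Kernel evaluation of the `(b₁, c₁) = (4, 7)` subtree (1435 nodes). -/
theorem checkFrom_cyc11_4_7 : checkFrom (cyc 11) 6 4 7 = true := by decide +kernel

/-- Kernel evaluation of the `(b₁, c₁) = (4, 8)` subtree (1435 nodes). -/
theorem checkFrom_cyc11_4_8 : checkFrom (cyc 11) 6 4 8 = true := by decide +kernel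

/-- Kernel evaluation of the `(b₁, c₁) = (4, 9)` subtree (1557 nodes). -/
theorem checkFrom_cyc11_4_9 : checkFrom (cyc 11) 6 4 9 = true := by decide +kernel

/-- Kernel evaluation of the `(b₁, c₁) = (4, 10)` subtree (1776 nodes). -/
theorem checkFrom_cyc11_4_10 : checkFrom (cyc 11) 6 4 10 = true := by decide +kernel

/-- All level-1 choices `c₁ = y` below `b₁ = 4` are refuted (heavy `y` from the part files, light ones evaluated here). -/
theorem checkFrom_cyc11_4 : ∀ y, y < 11 → checkFrom (cyc 11) 6 4 y = true := by
  intro y hy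
  interval_cases y
  exacts [by decide +kernel, checkFrom_cyc11_4_1, checkFrom_cyc11_4_2, checkFrom_cyc11_4_3, by decide +kernel, checkFrom_cyc11_4_5, checkFrom_cyc11_4_6, checkFrom_cyc11_4_7, checkFrom_cyc11_4_8, checkFrom_cyc11_4_9, checkFrom_cyc11_4_10]

end IcosetH

end Summit.MatrixMultiplication.OmegaCensus
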